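import Mathlib.Tactic.Group
import Mathlib.Tactic.FinCases
import Mathlib.Algebra.Group.Conj
import Mathlib.Algebra.Group.TypeTags.Basic
import Mathlib.GroupTheory.QuotientGroup.Basic
import Literature.Topology.FourManifolds.MillerSchuppACSeries
import Literature.Topology.FourManifolds.BalancedPresentationBasisChange
import HarnessLib

/-!
# `MS(1, w)` and `MS(n, w⋆)` are Andrews–Curtis trivial — for all `w` and all `n`

Topic `Literature/Topology/FourManifolds`.  Kernel-checked reproductions, uniform in the parameters,
of Shehper et al. 2025, **Theorem 2** — the Miller–Schupp presentation
`MS(1, w) = ⟨x, y ∣ x⁻¹ y x = y², x = w⟩` is Andrews–Curtis trivial for EVERY word `w` of exponent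
sum `0` in `x` (`isAndrewsCurtisEquivalent_millerSchuppOne_trivial`) — and **Theorem 3** —
`MS(n, w⋆) = ⟨x, y ∣ x⁻¹ yⁿ x = yⁿ⁺¹, x = w⋆⟩`, `w⋆ = y⁻¹ x y x⁻¹`, is Andrews–Curtis trivial for
EVERY `n` (`isAndrewsCurtisEquivalent_millerSchuppStar_trivial`; the instances `n ≤ 5` are also
certificate records in `AndrewsCurtisCertificateRecords.lean`).

The published proof of Theorem 2 moves the letters `x^{±1}` of the second relator past the `y`'s
using the four rewritings of `x⁻¹ y x = y²` until it reads `x^{a-1} y^b x^{-a}`.  Here this is the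
normal form `x^a y^b x^c` in the quotient `F₂ / ⟪x⁻¹yxy⁻²⟫` (the Baumslag–Solitar group `BS(1, 2)`),
proved for all words by induction (`bs12_exists_normalForm`, with `a + c` the `x`-exponent sum),
after which the Andrews–Curtis moves are: multiply `r₁` by the consequence `r₁⁻¹ · x^a y^b x^c`
of `r₀` (`IsAndrewsCurtisEquivalent.update_mul_of_mem_normalClosure`), conjugate to `y^b x`,
substitute `x ↦ y^{-b}` in `r₀` (which becomes `y⁻¹`), invert, cancel `y^b`, swap.  Theorem 3 is
reduced to Theorem 2 exactly as published: after `x ↔ y` the presentation `MS(n, w⋆)` is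
`MS(1, y⁻¹xⁿyx⁻ⁿ)` up to inverting and transposing the relators; the relabelling is transported with
`isAndrewsCurtisEquivalent_freeGroupCongr_comp_trivial`.

Source: A. Shehper, A. M. Medina-Mardones, L. Fagan, B. Lewandowski, A. Gruen, Y. Qiu, P. Kucharski,
Z. Wang, S. Gukov, *What makes math problems hard for reinforcement learning: a case study*, 2025,
§3.4, Theorems 2 and 3 with proofs [cite: ShehperEtAl2025ACHardRL] (which also reports that
AC-trivialisations of `MS(n, w⋆)`, `3 ≤ n ≤ 8`, had been obtained by automated theorem proving in
its reference [Lis24] — not used here).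
-/

namespace Literature.Topology.FourManifolds

open Function

/-! ### The presentations and the `x`-exponent sum -/

/-- `MS(1, w) = ⟨x, y ∣ x⁻¹ y x = y², x = w⟩`, encoded as `![x⁻¹ y¹ x (y¹⁺¹)⁻¹, x w⁻¹]` (so that
`millerSchuppK 1 k = millerSchuppOne w_k` definitionally). [cite: ShehperEtAl2025ACHardRL, Thm 2] -/
def millerSchuppOne (w : FreeGroup (Fin 2)) : BalancedPresentation 2 :=
  ![(FreeGroup.of 0)⁻¹ * FreeGroup.of 1 ^ 1 * FreeGroup.of 0 * (FreeGroup.of 1 ^ (1 + 1))⁻¹,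
    FreeGroup.of 0 * w⁻¹]

/-- `MS(1, w_k)` is `millerSchuppOne w_k`. [cite: ShehperEtAl2025ACHardRL, Thm 6] -/
theorem millerSchuppK_one_eq (k : ℤ) :
    millerSchuppK 1 k = millerSchuppOne
      (FreeGroup.of 1 ^ (-k) * (FreeGroup.of 0)⁻¹ * FreeGroup.of 1 * FreeGroup.of 0 *
        FreeGroup.of 1) :=
  rfl

/-- `MS(n, w⋆) = ⟨x, y ∣ x⁻¹ yⁿ x = yⁿ⁺¹, x = w⋆⟩`, `w⋆ = y⁻¹ x y x⁻¹`.
[cite: ShehperEtAl2025ACHardRL, Thm 3] -/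
def millerSchuppStar (n : ℕ) : BalancedPresentation 2 :=
  ![(FreeGroup.of 0)⁻¹ * FreeGroup.of 1 ^ n * FreeGroup.of 0 * (FreeGroup.of 1 ^ (n + 1))⁻¹,
    FreeGroup.of 0 * ((FreeGroup.of 1)⁻¹ * FreeGroup.of 0 * FreeGroup.of 1 * (FreeGroup.of 0)⁻¹)⁻¹]

/-- The exponent sum of `x = x₀` in a word of `F₂`, as a homomorphism to `ℤ` (written
multiplicatively). [folklore] -/
def xExpSum : FreeGroup (Fin 2) →* Multiplicative ℤ :=
  FreeGroup.lift ![Multiplicative.ofAdd 1, 1]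

/-- `σₓ(x) = 1`. [folklore] -/
@[simp] theorem xExpSum_of_zero : xExpSum (FreeGroup.of 0) = Multiplicative.ofAdd 1 := by
  simp [xExpSum]

/-- `σₓ(y) = 0`. [folklore] -/
@[simp] theorem xExpSum_of_one : xExpSum (FreeGroup.of 1) = 1 := by
  simp [xExpSum]

/-! ### Two more moves on `![u, v]` -/

section Moves

variable {u v : FreeGroup (Fin 2)}

/-- Transposing the relators. [folklore] -/
theorem acPair_swap : IsAndrewsCurtisEquivalent ![u, v] ![v, u] := by
  convert IsAndrewsCurtisEquivalent.comp_swap ![u, v] 0 1 using 2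
  ext i; fin_cases i <;> simp

/-- The trivial presentation on two generators is `![x, y]`. [folklore] -/
theorem trivial_two_eq_vec :
    BalancedPresentation.trivial 2 = ![FreeGroup.of 0, FreeGroup.of 1] := by
  ext i; fin_cases i <;> rfl

/-- Applying a map to both relators. [folklore] -/
theorem comp_vec_two {β : Type*} (f : FreeGroup (Fin 2) → β) (u v : FreeGroup (Fin 2)) :
    f ∘ ![u, v] = ![f u, f v] := by
  ext i; fin_cases i <;> rfl

end Moves

/-! ### The normal form `xᵃ yᵇ xᶜ` modulo `x⁻¹ y x = y²` -/

section NormalForm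

/-- The relator `x⁻¹ y x y⁻²` of `BS(1, 2)`, literally as it appears in `millerSchuppOne`.
[folklore] -/
def bs12Rel : FreeGroup (Fin 2) :=
  (FreeGroup.of 0)⁻¹ * FreeGroup.of 1 ^ 1 * FreeGroup.of 0 * (FreeGroup.of 1 ^ (1 + 1))⁻¹

/-- Its normal closure `⟪x⁻¹yxy⁻²⟫`; the quotient is the Baumslag–Solitar group `BS(1, 2)`.
[folklore] -/
abbrev bs12Ker : Subgroup (FreeGroup (Fin 2)) := Subgroup.normalClosure {bs12Rel}

local notation "qx" => (QuotientGroup.mk (FreeGroup.of 0) : FreeGroup (Fin 2) ⧸ bs12Ker)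
local notation "qy" => (QuotientGroup.mk (FreeGroup.of 1) : FreeGroup (Fin 2) ⧸ bs12Ker)

/-- In `F₂ / ⟪x⁻¹yxy⁻²⟫`: `x⁻¹ y x = y²`. [folklore] -/
theorem bs12_rel : qx⁻¹ * qy * qx = qy ^ 2 := by
  have h : (((FreeGroup.of 0)⁻¹ * FreeGroup.of 1 ^ 1 * FreeGroup.of 0 *
      (FreeGroup.of 1 ^ (1 + 1))⁻¹ : FreeGroup (Fin 2)) : FreeGroup (Fin 2) ⧸ bs12Ker) = 1 :=
    (QuotientGroup.eq_one_iff _).2 (Subgroup.subset_normalClosure rfl)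
  have h' : qx⁻¹ * qy ^ 1 * qx * (qy ^ (1 + 1))⁻¹ = 1 := by
    simpa only [QuotientGroup.mk_mul, QuotientGroup.mk_inv, QuotientGroup.mk_pow] using h
  rw [mul_inv_eq_one] at h'
  simpa using h'

/-- `x⁻¹ yⁱ x = y²ⁱ` in the quotient. [folklore] -/
theorem bs12_conj_zpow (i : ℤ) : qx⁻¹ * qy ^ i * qx = qy ^ (2 * i) := by
  have h := conj_zpow (a := qx⁻¹) (b := qy) (i := i)
  simp only [inv_inv] at h
  rw [bs12_rel] at h
  rw [← h]
  group

/-- `x⁻ᵐ yʲ xᵐ = y^(j·2ᵐ)` in the quotient. [folklore] -/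
theorem bs12_zpow_conj_zpow (m : ℕ) (j : ℤ) :
    qx ^ (-(m : ℤ)) * qy ^ j * qx ^ (m : ℤ) = qy ^ (j * 2 ^ m) := by
  induction m with
  | zero => simp
  | succ m ih =>
    calc qx ^ (-((m + 1 : ℕ) : ℤ)) * qy ^ j * qx ^ ((m + 1 : ℕ) : ℤ)
        = qx⁻¹ * (qx ^ (-(m : ℤ)) * qy ^ j * qx ^ (m : ℤ)) * qx := by push_cast; group
      _ = qx⁻¹ * qy ^ (j * 2 ^ m) * qx := by rw [ih]
      _ = qy ^ (2 * (j * 2 ^ m)) := bs12_conj_zpow _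
      _ = qy ^ (j * 2 ^ (m + 1)) := by congr 1; ring

/-- Products of normal forms are normal forms, with additive `x`-exponents. [folklore] -/
theorem bs12_normalForm_mul (a b c a' b' c' : ℤ) :
    ∃ a'' b'' c'' : ℤ, a'' + c'' = (a + c) + (a' + c') ∧
      qx ^ a * qy ^ b * qx ^ c * (qx ^ a' * qy ^ b' * qx ^ c') =
        qx ^ a'' * qy ^ b'' * qx ^ c'' := by
  rcases le_or_gt 0 (c + a') with h | h
  · -- `c + a' = t ≥ 0`:  `yᵇ xᵗ = xᵗ y^(b 2ᵗ)`
    obtain ⟨t, ht⟩ : ∃ t : ℕ, (t : ℤ) = c + a' := ⟨(c + a').toNat, Int.toNat_of_nonneg h⟩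
    have key : qy ^ b * qx ^ (t : ℤ) = qx ^ (t : ℤ) * qy ^ (b * 2 ^ t) := by
      rw [← bs12_zpow_conj_zpow t b]; group
    refine ⟨a + t, b * 2 ^ t + b', c', by omega, ?_⟩
    calc qx ^ a * qy ^ b * qx ^ c * (qx ^ a' * qy ^ b' * qx ^ c')
        = qx ^ a * (qy ^ b * qx ^ (c + a')) * qy ^ b' * qx ^ c' := by group
      _ = qx ^ a * (qy ^ b * qx ^ (t : ℤ)) * qy ^ b' * qx ^ c' := by rw [ht]
      _ = qx ^ a * (qx ^ (t : ℤ) * qy ^ (b * 2 ^ t)) * qy ^ b' * qx ^ c' := by rw [key]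
      _ = qx ^ (a + t) * qy ^ (b * 2 ^ t + b') * qx ^ c' := by group
  · -- `c + a' = -t < 0`:  `x⁻ᵗ yᵇ' = y^(b' 2ᵗ) x⁻ᵗ`
    obtain ⟨t, ht⟩ : ∃ t : ℕ, (t : ℤ) = -(c + a') :=
      ⟨(-(c + a')).toNat, Int.toNat_of_nonneg (by omega)⟩
    have key : qx ^ (-(t : ℤ)) * qy ^ b' = qy ^ (b' * 2 ^ t) * qx ^ (-(t : ℤ)) := by
      rw [← bs12_zpow_conj_zpow t b']; group
    refine ⟨a, b + b' * 2 ^ t, c' - t, by omega, ?_⟩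
    have ht' : c + a' = -(t : ℤ) := by omega
    calc qx ^ a * qy ^ b * qx ^ c * (qx ^ a' * qy ^ b' * qx ^ c')
        = qx ^ a * qy ^ b * (qx ^ (c + a') * qy ^ b') * qx ^ c' := by group
      _ = qx ^ a * qy ^ b * (qx ^ (-(t : ℤ)) * qy ^ b') * qx ^ c' := by rw [ht']
      _ = qx ^ a * qy ^ b * (qy ^ (b' * 2 ^ t) * qx ^ (-(t : ℤ))) * qx ^ c' := by rw [key]
      _ = qx ^ a * qy ^ (b + b' * 2 ^ t) * qx ^ (c' - t) := by group

/-- **Normal form in `BS(1, 2) = F₂ / ⟪x⁻¹yxy⁻²⟫`**: every word equals some `xᵃ yᵇ xᶜ` modulo the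
relator, with `a + c` its `x`-exponent sum. [folklore] -/
theorem bs12_exists_normalForm (g : FreeGroup (Fin 2)) :
    ∃ a b c : ℤ, xExpSum g = Multiplicative.ofAdd (a + c) ∧
      (g : FreeGroup (Fin 2) ⧸ bs12Ker) = qx ^ a * qy ^ b * qx ^ c := by
  induction g with
  | C1 => exact ⟨0, 0, 0, by simp, by simp⟩
  | of i =>
    fin_cases i
    · exact ⟨1, 0, 0, by simp, by simp⟩
    · exact ⟨0, 1, 0, by simp, by simp⟩
  | inv_of i ih =>
    obtain ⟨a, b, c, hσ, hq⟩ := ih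
    refine ⟨-c, -b, -a, ?_, ?_⟩
    · rw [map_inv, hσ, ← ofAdd_neg]; congr 1; ring
    · rw [QuotientGroup.mk_inv, hq]; group
  | mul g h ihg ihh =>
    obtain ⟨a, b, c, hσ, hq⟩ := ihg
    obtain ⟨a', b', c', hσ', hq'⟩ := ihh
    obtain ⟨a'', b'', c'', hsum, hprod⟩ := bs12_normalForm_mul a b c a' b' c'
    refine ⟨a'', b'', c'', ?_, ?_⟩
    · rw [map_mul, hσ, hσ', ← ofAdd_add, hsum]
    · rw [QuotientGroup.mk_mul, hq, hq', hprod]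

end NormalForm

/-! ### Theorem 2: `MS(1, w)` is Andrews–Curtis trivial -/

/-- Steps 3–6 of the proof of Theorem 2: `⟨x, y ∣ x⁻¹yxy⁻², yᵇx⟩` is Andrews–Curtis trivial —
substitute `x ↦ y⁻ᵇ` in `r₀` (which becomes `y⁻¹`), invert, cancel `yᵇ` against `r₀ = y`, swap.
[cite: ShehperEtAl2025ACHardRL, Thm 2 (proof)] -/
theorem isAndrewsCurtisEquivalent_bs12Rel_zpow_mul_trivial (b : ℤ) :
    IsAndrewsCurtisEquivalent
      ![(FreeGroup.of 0)⁻¹ * FreeGroup.of 1 ^ 1 * FreeGroup.of 0 * (FreeGroup.of 1 ^ (1 + 1))⁻¹,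
        FreeGroup.of 1 ^ b * FreeGroup.of 0]
      (BalancedPresentation.trivial 2) := by
  set x : FreeGroup (Fin 2) := FreeGroup.of 0 with hx
  set y : FreeGroup (Fin 2) := FreeGroup.of 1 with hy
  set r₀ : FreeGroup (Fin 2) := x⁻¹ * y ^ 1 * x * (y ^ (1 + 1))⁻¹ with hr₀
  set v : FreeGroup (Fin 2) := y ^ b * x with hv
  rw [trivial_two_eq_vec, ← hx, ← hy]
  -- Step 3: substitute `x ↦ y⁻ᵇ` in `r₀`: multiply `r₀` by `r₀⁻¹ φ(r₀) ∈ ⟪v⟫`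
  set φ : FreeGroup (Fin 2) →* FreeGroup (Fin 2) := FreeGroup.lift ![y ^ (-b), y] with hφ
  have hmem : r₀⁻¹ * φ r₀ ∈
      Subgroup.normalClosure ((![r₀, v] : BalancedPresentation 2) '' {1}) := by
    have hS : ((![r₀, v] : BalancedPresentation 2) '' {1}) = {v} := by
      rw [Set.image_singleton]; rfl
    rw [hS]
    haveI : (Subgroup.normalClosure ({v} : Set (FreeGroup (Fin 2)))).Normal :=
      Subgroup.normalClosure_normal
    refine inv_mul_lift_mem_of_forall_generator ![y ^ (-b), y] _ (Fin.forall_fin_two.2 ⟨?_, ?_⟩) r₀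
    · -- `x⁻¹ y⁻ᵇ = v⁻¹`
      have hvmem : v ∈ Subgroup.normalClosure ({v} : Set (FreeGroup (Fin 2))) :=
        Subgroup.subset_normalClosure rfl
      have e₁ : (FreeGroup.of (0 : Fin 2))⁻¹ * (![y ^ (-b), y] : Fin 2 → FreeGroup (Fin 2)) 0 =
          v⁻¹ := by
        simp only [Matrix.cons_val_zero]; rw [hv, ← hx]; group
      rw [e₁]
      exact Subgroup.inv_mem _ hvmem
    · have e₁ : (FreeGroup.of (1 : Fin 2))⁻¹ *
          (![y ^ (-b), y] : Fin 2 → FreeGroup (Fin 2)) 1 = 1 := by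
        simp only [Matrix.cons_val_one, Matrix.cons_val_zero]; rw [← hy]; group
      rw [e₁]
      exact Subgroup.one_mem _
  have step := IsAndrewsCurtisEquivalent.update_mul_of_mem_normalClosure
    (![r₀, v] : BalancedPresentation 2) (i := 0) (S := {1}) (by decide) hmem
  have eupd : update (![r₀, v] : BalancedPresentation 2) 0
      ((![r₀, v] : BalancedPresentation 2) 0 * (r₀⁻¹ * φ r₀)) = ![φ r₀, v] := by
    ext i; fin_cases i <;> simp
  rw [eupd] at step
  refine step.trans ?_
  have hφr : φ r₀ = y⁻¹ := by
    have hφx : φ x = y ^ (-b) := by rw [hφ, hx, FreeGroup.lift_apply_of]; rfl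
    have hφy : φ y = y := by rw [hφ, hy, FreeGroup.lift_apply_of]; rfl
    rw [hr₀, map_mul, map_mul, map_mul, map_inv, map_inv, map_pow, map_pow, hφx, hφy]
    group
  rw [hφr]
  -- Step 4: invert `r₀`
  refine (acPair_inv₀ (u' := y) (by group)).trans ?_
  -- Step 5: `r₁ ↦ r₁ · (x⁻¹ y⁻ᵇ x) = x`, a consequence of `r₀ = y`
  have hmem₃ : x⁻¹ * y ^ (-b) * x⁻¹⁻¹ ∈
      Subgroup.normalClosure ((![y, v] : BalancedPresentation 2) '' {0}) := by
    have hS : ((![y, v] : BalancedPresentation 2) '' {0}) = {y} := by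
      rw [Set.image_singleton]; rfl
    rw [hS]
    have hymem : y ∈ Subgroup.normalClosure ({y} : Set (FreeGroup (Fin 2))) :=
      Subgroup.subset_normalClosure rfl
    have hyb : y ^ (-b) ∈ Subgroup.normalClosure ({y} : Set (FreeGroup (Fin 2))) :=
      Subgroup.zpow_mem _ hymem (-b)
    exact (Subgroup.normalClosure_normal (s := ({y} : Set (FreeGroup (Fin 2))))).conj_mem _ hyb x⁻¹
  have step₃ := IsAndrewsCurtisEquivalent.update_mul_of_mem_normalClosure
    (![y, v] : BalancedPresentation 2) (i := 1) (S := {0}) (by decide) hmem₃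
  have hv' : v * (x⁻¹ * y ^ (-b) * x⁻¹⁻¹) = x := by rw [hv]; group
  have eupd₃ : update (![y, v] : BalancedPresentation 2) 1
      ((![y, v] : BalancedPresentation 2) 1 * (x⁻¹ * y ^ (-b) * x⁻¹⁻¹)) = ![y, x] := by
    have h₁ : (![y, v] : BalancedPresentation 2) 1 * (x⁻¹ * y ^ (-b) * x⁻¹⁻¹) = x := by
      change v * (x⁻¹ * y ^ (-b) * x⁻¹⁻¹) = x
      exact hv'
    rw [h₁]
    ext i; fin_cases i <;> simp
  rw [eupd₃] at step₃
  -- Step 6: swap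
  exact step₃.trans acPair_swap

/-- **Shehper et al. 2025, Thm. 2: `MS(1, w) = ⟨x, y ∣ x⁻¹yx = y², x = w⟩` is Andrews–Curtis trivial
for every word `w` with exponent sum `0` in `x`.**  Steps 1–2: bring `r₁ = x w⁻¹` to its normal
form `xᵃ yᵇ x¹⁻ᵃ` modulo `r₀` (a multiplication by an element of `⟪r₀⟫`), conjugate to `yᵇ x`; then
`isAndrewsCurtisEquivalent_bs12Rel_zpow_mul_trivial`. [cite: ShehperEtAl2025ACHardRL, Thm 2] -/
theorem isAndrewsCurtisEquivalent_millerSchuppOne_trivial (w : FreeGroup (Fin 2))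
    (hw : xExpSum w = 1) :
    IsAndrewsCurtisEquivalent (millerSchuppOne w) (BalancedPresentation.trivial 2) := by
  set x : FreeGroup (Fin 2) := FreeGroup.of 0 with hx
  set y : FreeGroup (Fin 2) := FreeGroup.of 1 with hy
  set g : FreeGroup (Fin 2) := x * w⁻¹ with hg
  -- the normal form of `g = x w⁻¹` modulo `r₀`
  obtain ⟨a, b, c, hσ, hq⟩ := bs12_exists_normalForm g
  have hac : a + c = 1 := by
    have h1 : xExpSum g = Multiplicative.ofAdd 1 := by
      rw [hg, map_mul, map_inv, hw, hx, xExpSum_of_zero, inv_one, mul_one]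
    exact Multiplicative.ofAdd.injective (hσ.symm.trans h1)
  obtain rfl : c = 1 - a := by omega
  set r₀ : FreeGroup (Fin 2) := x⁻¹ * y ^ 1 * x * (y ^ (1 + 1))⁻¹ with hr₀
  have e : millerSchuppOne w = ![r₀, g] := rfl
  rw [e]
  -- Step 1: `r₁ ↦ r₁ · (r₁⁻¹ xᵃ yᵇ x¹⁻ᵃ)`, a consequence of `r₀`
  have hmem : g⁻¹ * (x ^ a * y ^ b * x ^ (1 - a)) ∈
      Subgroup.normalClosure ((![r₀, g] : BalancedPresentation 2) '' {0}) := by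
    have hS : ((![r₀, g] : BalancedPresentation 2) '' {0}) = {bs12Rel} := by
      rw [Set.image_singleton]; rfl
    rw [hS]
    refine QuotientGroup.eq.1 ?_
    rw [hq, hx, hy]
    simp only [QuotientGroup.mk_mul, QuotientGroup.mk_zpow]
  have step := IsAndrewsCurtisEquivalent.update_mul_of_mem_normalClosure
    (![r₀, g] : BalancedPresentation 2) (i := 1) (S := {0}) (by decide) hmem
  have eupd : update (![r₀, g] : BalancedPresentation 2) 1
      ((![r₀, g] : BalancedPresentation 2) 1 * (g⁻¹ * (x ^ a * y ^ b * x ^ (1 - a)))) =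
      ![r₀, x ^ a * y ^ b * x ^ (1 - a)] := by
    ext i; fin_cases i <;> simp
  rw [eupd] at step
  refine step.trans ?_
  -- Step 2: conjugate `r₁` by `x⁻ᵃ`: `r₁ = yᵇ x`
  refine (acPair_conj₁ (x ^ (-a)) (v' := y ^ b * x) (by group)).trans ?_
  -- Steps 3–6
  exact isAndrewsCurtisEquivalent_bs12Rel_zpow_mul_trivial b

/-- `MS(1, w_k)` is Andrews–Curtis trivial for every `k ∈ ℤ`.
[cite: ShehperEtAl2025ACHardRL, Thm 2] -/
theorem isAndrewsCurtisEquivalent_millerSchuppK_one_trivial (k : ℤ) :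
    IsAndrewsCurtisEquivalent (millerSchuppK 1 k) (BalancedPresentation.trivial 2) := by
  rw [millerSchuppK_one_eq]
  refine isAndrewsCurtisEquivalent_millerSchuppOne_trivial _ ?_
  simp [map_zpow]

/-! ### Theorem 3: `MS(n, w⋆)` is Andrews–Curtis trivial -/

/-- **Shehper et al. 2025, Thm. 3: `MS(n, w⋆)`, `w⋆ = y⁻¹xyx⁻¹`, is Andrews–Curtis trivial for every
`n`.**  As published: `x = y⁻¹xyx⁻¹` reads `y⁻¹xy = x²`, so after `x ↔ y` the presentation is
`MS(1, y⁻¹xⁿyx⁻ⁿ)` (up to inverting and transposing the relators), which is Andrews–Curtis trivial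
by Theorem 2. [cite: ShehperEtAl2025ACHardRL, Thm 3] -/
theorem isAndrewsCurtisEquivalent_millerSchuppStar_trivial (n : ℕ) :
    IsAndrewsCurtisEquivalent (millerSchuppStar n) (BalancedPresentation.trivial 2) := by
  set x : FreeGroup (Fin 2) := FreeGroup.of 0 with hx
  set y : FreeGroup (Fin 2) := FreeGroup.of 1 with hy
  -- `P' = MS(1, w')`, `w' = y⁻¹ xⁿ y x⁻ⁿ`, is AC-trivial by Theorem 2
  have hσ : xExpSum (y⁻¹ * x ^ n * y * (x ^ n)⁻¹) = 1 := by
    rw [map_mul, map_mul, map_mul, map_inv, map_inv, map_pow, hy, xExpSum_of_one]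
    group
  have h₁ := isAndrewsCurtisEquivalent_millerSchuppOne_trivial _ hσ
  -- transport along the relabelling `θ : x ↔ y`
  have h₂ := IsAndrewsCurtisEquivalent.comp_of_trivial
    (FreeGroup.freeGroupCongr (Equiv.swap (0 : Fin 2) 1))
    (isAndrewsCurtisEquivalent_freeGroupCongr_comp_trivial (Equiv.swap (0 : Fin 2) 1)) h₁
  have hθx : FreeGroup.freeGroupCongr (Equiv.swap (0 : Fin 2) 1) x = y := by
    rw [hx, hy, FreeGroup.freeGroupCongr_apply, FreeGroup.map.of, Equiv.swap_apply_left]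
  have hθy : FreeGroup.freeGroupCongr (Equiv.swap (0 : Fin 2) 1) y = x := by
    rw [hx, hy, FreeGroup.freeGroupCongr_apply, FreeGroup.map.of, Equiv.swap_apply_right]
  have eP : millerSchuppOne (y⁻¹ * x ^ n * y * (x ^ n)⁻¹) =
      ![x⁻¹ * y ^ 1 * x * (y ^ (1 + 1))⁻¹, x * (y⁻¹ * x ^ n * y * (x ^ n)⁻¹)⁻¹] := rfl
  have e : ⇑(FreeGroup.freeGroupCongr (Equiv.swap (0 : Fin 2) 1)) ∘
        millerSchuppOne (y⁻¹ * x ^ n * y * (x ^ n)⁻¹) =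
      ![y⁻¹ * x ^ 1 * y * (x ^ (1 + 1))⁻¹, y * (x⁻¹ * y ^ n * x * (y ^ n)⁻¹)⁻¹] := by
    rw [eP, comp_vec_two]
    simp only [map_mul, map_inv, map_pow, hθx, hθy]
  rw [e] at h₂
  -- `MS(n, w⋆) = ![ρ₁⁻¹, ρ₀⁻¹]` for `θ ∘ P' = ![ρ₀, ρ₁]`: invert both relators and swap
  have e' : millerSchuppStar n =
      ![x⁻¹ * y ^ n * x * (y ^ (n + 1))⁻¹, x * (y⁻¹ * x * y * x⁻¹)⁻¹] := rfl
  rw [e']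
  refine (acPair_inv₀ (u' := y * (x⁻¹ * y ^ n * x * (y ^ n)⁻¹)⁻¹) (by group)).trans ?_
  refine (acPair_inv₁ (v' := y⁻¹ * x ^ 1 * y * (x ^ (1 + 1))⁻¹) (by group)).trans ?_
  exact acPair_swap.trans h₂

end Literature.Topology.FourManifolds
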